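import Literature.RepresentationTheory.KonnoKonno2007.JunctionVacuumSectionSwap
import Literature.RepresentationTheory.KonnoKonno2007.JunctionHyperbolicVacuumPin
import HarnessLib

/-!
# The `W`-side hyperbolic family is the Levi family of the `W`-frame

Reconciliation of the two closed forms of the canonical section of the junction `U(P,Q) × U(R,S) ↪ Sp` on the
boosts `(1, a'_t)` of the SECOND factor: theta-1's swap-transported family `hypOpW P Q r₀ s₀ t`
(`JunctionSwapBargmann`, pinned to the section in `JunctionHyperbolicVacuumPin`) and weil-2's conjugated Levi
family `μ₀(u)⁻¹ ∘ leviS (planeDilW t) ∘ μ₀(u)`, `u = frameW` (`JunctionVacuumSectionSwap`).  Both implement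
`ι𝕎 (1, hypV r₀ s₀ t)` with a positive-real vacuum coefficient, so both equal `vacSection` there
(`eq_vacSection`) — hence each other.  Hypothesis-free (no rank-one binder).  Reproduction kernel, [folklore]
bookkeeping over [cite: Folland1989, (4.24), Prop. (4.39)]; no definitions, no records.
-/

open MeasureTheory Complex
open scoped InnerProductSpace ComplexConjugate Real

noncomputable section

namespace Literature.RepresentationTheory.KonnoKonno2007

open Literature.Analysis.SegalBargmann Literature.RepresentationTheory.HeisenbergGroup
open Literature.NumberTheory.Weil1964

namespace RealDualPair

open Literature.NumberTheory.Automorphic Literature.NumberTheory.Automorphic.UnitaryGroup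

section Reconcile

local notation "SR" σ => SchwartzMap (σ → ℝ) ℂ
local notation "PV" σ => (σ → ℝ) × (σ → ℝ)

variable (P Q : Type*) {R S : Type*} [Fintype P] [DecidableEq P] [Fintype Q] [DecidableEq Q] [Fintype R]
  [DecidableEq R] [Fintype S] [DecidableEq S] (r₀ : R) (s₀ : S)

set_option quotPrecheck false in
local notation "γ𝕎[" P ", " Q ", " R ", " S "]" =>
  fun g : Ginf P Q R S => (⇑((ι𝕎 P Q R S g).1 : (PV (DPIdx P Q R S)) ≃ₗ[ℝ] PV (DPIdx P Q R S)) :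
    PhaseMap (DPIdx P Q R S))

/-- **`hypOpW` is the Levi family of the `W`-boost in its frame**: the swap-transported hyperbolic family
`hypOpW P Q r₀ s₀ t` (theta-1, `JunctionSwapBargmann`) equals `μ₀(u)⁻¹ ∘ leviS (planeDilW t) ∘ μ₀(u)`,
`u = frameW` (weil-2, this file) — both are the canonical section at `(1, hypV r₀ s₀ t)`: each implements
`ι𝕎 (1, hypV r₀ s₀ t)` with positive-real vacuum coefficient. [cite: Folland1989, (4.24), Prop. (4.39)] -/
theorem hypOpW_eq_conj_leviS (t : ℝ) :
    hypOpW P Q r₀ s₀ t =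
      (unitaryOpPi (frameW P Q r₀ s₀)⁻¹).comp
        ((leviS (planeDilW P Q r₀ s₀ t)).comp (unitaryOpPi (frameW P Q r₀ s₀))) := by
  rw [← vacSection_junction_one_hypV_eq_hypOpW P Q r₀ s₀ t]
  symm
  refine eq_vacSection (γ := γ𝕎[P, Q, R, S])
    (g := (((1 : UForm P Q), (hypV r₀ s₀ t : UForm R S)) : Ginf P Q R S)) ?_ ?_ ?_
  · have had : ∀ x y : DPIdx P Q R S → ℝ,
        planeDilW P Q r₀ s₀ t x ⬝ᵥ (planeDilW P Q r₀ s₀ t).symm y = x ⬝ᵥ y := by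
      intro x y
      rw [planeDilW, reindexLin_symm]
      exact reindexLin_dotProduct (swapIdx P Q R S)
        (planeDil_dotProduct_symm P Q r₀ s₀ (Real.exp t) (Real.exp_pos t).ne') x y
    convert isImplementerS_conj_leviS (frameW P Q r₀ s₀) had using 2
    funext pq
    exact ι𝕎_one_hypV_eq_conj_leviPhase P Q r₀ s₀ t pq
  · rw [vacCoeffS_conj_leviS]
    exact vacCoeffS_leviS_eq_norm _
  · exact vacCoeffS_conj_leviS_ne_zero _ _

/-- … equivalently, the canonical section at `(1, hypV r₀ s₀ t)` in the Levi form of `JunctionVacuumSectionSwap`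
(hypothesis-free companion of `kakImplementerData_junction_swap`). [cite: Folland1989, (4.24), Prop. (4.39)] -/
theorem vacSection_junction_one_hypV_eq_conj_leviS (t : ℝ) :
    vacSection (γ𝕎[P, Q, R, S]) (((1 : UForm P Q), (hypV r₀ s₀ t : UForm R S)) : Ginf P Q R S) =
      (unitaryOpPi (frameW P Q r₀ s₀)⁻¹).comp
        ((leviS (planeDilW P Q r₀ s₀ t)).comp (unitaryOpPi (frameW P Q r₀ s₀))) := by
  rw [vacSection_junction_one_hypV_eq_hypOpW, hypOpW_eq_conj_leviS]

/-- … and a genuine Weil datum `ω` (an `IsArchWeilDatum` over `ι𝕎`) on the `W`-boosts, in the Levi form.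
[cite: Folland1989, §4.2 p. 156, Prop. (4.39)] -/
theorem weilDatum_apply_one_hypV_eq_conj_leviS
    {ω : Representation ℂ (Ginf P Q R S) (SR (DPIdx P Q R S))} (hW : IsArchWeilDatum (ι𝕎 P Q R S) ω)
    (t : ℝ) (f : SR (DPIdx P Q R S)) :
    ω (((1 : UForm P Q), (hypV r₀ s₀ t : UForm R S)) : Ginf P Q R S) f =
      unitaryOpPi (frameW P Q r₀ s₀)⁻¹ (leviS (planeDilW P Q r₀ s₀ t) (unitaryOpPi (frameW P Q r₀ s₀) f)) := by
  rw [weilDatum_apply_one_hypV_eq_hypOpW hW, hypOpW_eq_conj_leviS]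
  rfl

end Reconcile

end RealDualPair

end Literature.RepresentationTheory.KonnoKonno2007

end
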